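import Literature.NumberTheory.GaloisRepresentations.LocalReciprocityConjEquivariance
import HarnessLib

/-!
# Conjugation data relating the reciprocity systems of two finite subextensions

J. Neukirch, *Algebraic Number Theory*, Ch. IV, Prop. (5.8) (functoriality of the norm residue symbol
under `σ : (L|K) → (σL|σK)`): for a non-archimedean local field `F`, finite separable extensions
`E₁`, `E₂` of `F` read inside `F̄` as `E₁₀ = ι₁⁻¹(E₁)`, `E₂₀ = ι₂⁻¹(E₂)` (`embField`), and `g ∈ Γ_F` with
`g · E₁₀ = E₂₀`, the reciprocity data of `E₁` and `E₂` correspond under conjugation by `g`.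
`LocalReciprocityConjEquivariance.lean` (abc-iut-L6-t11, gen 3) did this for ONE normal `E`
(`γ : E ≃+* E`); this file is the TWO-FIELD version needed for non-normal subextensions
([AbsAnab] Prop. 1.2.1 (vi): compatibility of the local reciprocity maps of ALL open `U ≤ G_k` with
conjugation, `θ_{σUσ⁻¹}(σ x σ⁻¹) = σ · θ_U(x)`):

* §1 semilinear images `φ L'` of intermediate fields `L' ⊆ Ē₁` along a pair
  `(γ : E₁ ≃+* E₂, φ : Ē₁ ≃+* Ē₂)` with `φ ∘ algebraMap = algebraMap ∘ γ` (finiteness, Galois,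
  abelianness, restriction transported);
* §2 the conjugation data `φ_g = ι₂ ∘ g ∘ ι₁⁻¹`, `γ_g : E₁ ≃+* E₂` of `g ∈ Γ_F` with `g E₁₀ = E₂₀`;
* §3 the datum side for `ρ ∈ W_F`: `ρ U_{E₁} ρ⁻¹ = U_{E₂}`,
  `W_F ∩ G_{ι₂⁻¹(φ_ρ L')} = ρ (W_F ∩ G_{ι₁⁻¹ L'}) ρ⁻¹`, `ρ · ι₁⁻¹ x = ι₂⁻¹ (γ x)`, and the finite-level
  equivariance `(x, L'/E₁) = w|_{L'} ⟹ (γ x, φ_ρ L'/E₂) = (ρ w ρ⁻¹)|_{φ_ρ L'}` (`recMap_conjSub`).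

Sequel (`LocalReciprocityCrossConjEquivariance.lean`): the transport of representatives of `θ_E` and
the conjugation-equivariance of characterised reciprocity maps.  Proof-only (no definitions, no
named facts); classical local class field theory.  HONEST FRAMING (abc-iut cell): nothing here
bears on [IUTchIII] Cor. 3.12.  References: Neukirch IV (5.6), (5.8) [NeukirchANT1999]; Tate,
Corvallis (1.4.5) [TateCorvallis1979]; [AbsAnab] §1.2 p. 9–11 [MochizukiAbsAnab2004].
-/

noncomputable section

open Field IsNonarchimedeanLocalField ValuativeRel
open scoped Pointwise

namespace Literature.NumberTheory.GaloisRepresentations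

namespace LocalWeilDatum

open AbstractCFT AbstractCFT.WeilDatum

/-! ### §1 Semilinear images along `(γ : E₁ ≃+* E₂, φ : Ē₁ ≃+* Ē₂)` -/

section Semilinear

variable {E₁ E₂ : Type*} [Field E₁] [Field E₂]

/-- The image of an intermediate field `L' ⊆ Ē₁` under a ring isomorphism `φ : Ē₁ ≅ Ē₂` which is
`γ`-semilinear (`φ ∘ algebraMap = algebraMap ∘ γ`, `γ : E₁ ≅ E₂`) is an intermediate field of
`Ē₂/E₂` (existence form). [cite: NeukirchANT1999, Ch. IV Prop. (5.8)] -/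
theorem exists_intermediateField_semilinearImage₂ {γ : E₁ ≃+* E₂}
    {φ : AlgebraicClosure E₁ ≃+* AlgebraicClosure E₂}
    (hφ : ∀ x : E₁, φ (algebraMap E₁ (AlgebraicClosure E₁) x) =
      algebraMap E₂ (AlgebraicClosure E₂) (γ x))
    (L' : IntermediateField E₁ (AlgebraicClosure E₁)) :
    ∃ M : IntermediateField E₂ (AlgebraicClosure E₂), ∀ z, z ∈ M ↔ φ.symm z ∈ L' := by
  refine ⟨(L'.toSubfield.map φ.toRingHom).toIntermediateField fun x => ?_, fun z => ?_⟩
  · refine ⟨algebraMap E₁ (AlgebraicClosure E₁) (γ.symm x), L'.algebraMap_mem _, ?_⟩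
    change φ (algebraMap E₁ (AlgebraicClosure E₁) (γ.symm x)) = _
    rw [hφ, RingEquiv.apply_symm_apply]
  · change z ∈ L'.toSubfield.map φ.toRingHom ↔ _
    rw [Subfield.mem_map]
    constructor
    · rintro ⟨y, hy, rfl⟩
      change φ.symm (φ y) ∈ L'
      rw [RingEquiv.symm_apply_apply]
      exact hy
    · intro h
      exact ⟨φ.symm z, h, φ.apply_symm_apply z⟩

variable {γ : E₁ ≃+* E₂} {φ : AlgebraicClosure E₁ ≃+* AlgebraicClosure E₂}
  (hφ : ∀ x : E₁, φ (algebraMap E₁ (AlgebraicClosure E₁) x) =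
    algebraMap E₂ (AlgebraicClosure E₂) (γ x))
  {L' : IntermediateField E₁ (AlgebraicClosure E₁)} {M : IntermediateField E₂ (AlgebraicClosure E₂)}
  (hM : ∀ z, z ∈ M ↔ φ.symm z ∈ L')

include hM in
/-- `φ y ∈ φ L'` for `y ∈ L'`. [folklore] -/
private theorem map_mem_semilinearImage₂ {y : AlgebraicClosure E₁} (hy : y ∈ L') : φ y ∈ M := by
  rw [hM, RingEquiv.symm_apply_apply]
  exact hy

include hM in
/-- The ring isomorphism `L' ≅ φ L'` induced by `φ`, compatible with `γ` on the base fields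
(existence form). [cite: NeukirchANT1999, Ch. IV Prop. (5.8)] -/
theorem exists_ringEquiv_semilinearImage₂ :
    ∃ g : L' ≃+* M, (∀ y : L', ((g y : M) : AlgebraicClosure E₂) = φ y) ∧
      ((∀ x : E₁, φ (algebraMap E₁ (AlgebraicClosure E₁) x) =
          algebraMap E₂ (AlgebraicClosure E₂) (γ x)) →
        (algebraMap E₂ M).comp (γ : E₁ →+* E₂) = (g : L' →+* M).comp (algebraMap E₁ L')) := by
  refine ⟨{ toFun := fun y => ⟨φ y, map_mem_semilinearImage₂ hM y.2⟩
            invFun := fun z => ⟨φ.symm z, (hM z).mp z.2⟩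
            left_inv := fun y => Subtype.ext (φ.symm_apply_apply (y : AlgebraicClosure E₁))
            right_inv := fun z => Subtype.ext (φ.apply_symm_apply (z : AlgebraicClosure E₂))
            map_mul' := fun y y' => Subtype.ext (map_mul φ (y : AlgebraicClosure E₁) y')
            map_add' := fun y y' => Subtype.ext (map_add φ (y : AlgebraicClosure E₁) y') },
    fun _ => rfl, fun hφ => ?_⟩
  ext x
  change algebraMap E₂ (AlgebraicClosure E₂) (γ x) = φ (algebraMap E₁ (AlgebraicClosure E₁) x)
  rw [hφ]

include hφ hM in
/-- `φ L'` is finite over `E₂` when `L'` is finite over `E₁` (transport along `(γ, φ)`).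
[cite: NeukirchANT1999, Ch. IV Prop. (5.8)] -/
theorem finiteDimensional_semilinearImage₂ [FiniteDimensional E₁ L'] : FiniteDimensional E₂ M := by
  obtain ⟨g, -, hg⟩ := exists_ringEquiv_semilinearImage₂ hM
  exact Module.Finite.of_equiv_equiv γ g (hg hφ)

include hφ hM in
/-- `φ L'` is Galois over `E₂` when `L'` is Galois over `E₁` (`IsGalois.of_equiv_equiv`).
[cite: NeukirchANT1999, Ch. IV Prop. (5.8)] -/
theorem isGalois_semilinearImage₂ [IsGalois E₁ L'] : IsGalois E₂ M := by
  obtain ⟨g, -, hg⟩ := exists_ringEquiv_semilinearImage₂ hM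
  exact IsGalois.of_equiv_equiv (F := E₁) (E := L') (f := γ) (g := g) (hg hφ)

include hφ hM in
/-- `φ L'` is abelian over `E₂` when `L'` is abelian over `E₁`: `τ ↦ φ⁻¹ ∘ τ ∘ φ` embeds
`Gal(φL'/E₂)` into `Gal(L'/E₁)` multiplicatively. [cite: NeukirchANT1999, Ch. IV Prop. (5.8)] -/
theorem isAbelianGalois_semilinearImage₂ [IsAbelianGalois E₁ L'] : IsAbelianGalois E₂ M := by
  haveI := isGalois_semilinearImage₂ hφ hM
  obtain ⟨g, -, hg'⟩ := exists_ringEquiv_semilinearImage₂ hM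
  have hg : ∀ x : E₁, g (algebraMap E₁ L' x) = algebraMap E₂ M (γ x) := fun x =>
    (RingHom.congr_fun (hg' hφ) x).symm
  -- pull back an `E₂`-automorphism of `M` to an `E₁`-automorphism of `L'`
  let pull : (M ≃ₐ[E₂] M) → (L' ≃ₐ[E₁] L') := fun τ =>
    { (g.trans ((τ : M ≃+* M).trans g.symm) : L' ≃+* L') with
      commutes' := fun x => by
        change g.symm (τ (g (algebraMap E₁ L' x))) = algebraMap E₁ L' x
        rw [hg, AlgEquiv.commutes, ← hg, RingEquiv.symm_apply_apply] }
  have hpull : ∀ τ (y : L'), (pull τ y : L') = g.symm (τ (g y)) := fun _ _ => rfl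
  have hinj : Function.Injective pull := by
    intro τ₁ τ₂ h
    ext z
    have := congrArg (fun t : L' ≃ₐ[E₁] L' => (g (t (g.symm z)) : AlgebraicClosure E₂)) h
    simpa [hpull] using this
  have hmul : ∀ τ₁ τ₂, pull (τ₁ * τ₂) = pull τ₁ * pull τ₂ := by
    intro τ₁ τ₂
    ext y
    simp only [AlgEquiv.mul_apply, hpull, RingEquiv.apply_symm_apply]
  haveI : IsMulCommutative (M ≃ₐ[E₂] M) :=
    ⟨⟨fun τ₁ τ₂ => hinj (by rw [hmul, hmul]; exact IsMulCommutative.is_comm.comm _ _)⟩⟩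
  exact { toIsGalois := inferInstance, toIsMulCommutative := inferInstance }

/-- Restriction to `L'` determines restriction of the `φ`-conjugates to `φ L'`: if `σ`, `τ ∈ Γ_{E₁}`
agree on `L'` and `σ' ∘ φ = φ ∘ σ`, `τ' ∘ φ = φ ∘ τ` (`σ', τ' ∈ Γ_{E₂}`), then `σ'`, `τ'` agree on
`φ L'`. [cite: NeukirchANT1999, Ch. IV Prop. (5.8)] -/
theorem restrictNormalHom_eq_of_semilinear_conj₂ (hM : ∀ z, z ∈ M ↔ φ.symm z ∈ L')
    [Normal E₁ L'] [Normal E₂ M]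
    {σ τ : absoluteGaloisGroup E₁} {σ' τ' : absoluteGaloisGroup E₂}
    (hσ' : ∀ z, σ' • φ z = φ (σ • z)) (hτ' : ∀ z, τ' • φ z = φ (τ • z))
    (h : AlgEquiv.restrictNormalHom L' (absoluteGaloisGroup.toAlgEquiv E₁ σ) =
      AlgEquiv.restrictNormalHom L' (absoluteGaloisGroup.toAlgEquiv E₁ τ)) :
    AlgEquiv.restrictNormalHom M (absoluteGaloisGroup.toAlgEquiv E₂ σ') =
      AlgEquiv.restrictNormalHom M (absoluteGaloisGroup.toAlgEquiv E₂ τ') := by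
  ext z
  have hz : φ.symm (z : AlgebraicClosure E₂) ∈ L' := (hM z).mp z.2
  have h1 := congrArg (fun t : L' ≃ₐ[E₁] L' => ((t ⟨_, hz⟩ : L') : AlgebraicClosure E₁)) h
  simp only [AlgEquiv.restrictNormalHom_apply] at h1 ⊢
  rw [← absoluteGaloisGroup.smul_def, ← absoluteGaloisGroup.smul_def] at h1 ⊢
  change σ • φ.symm z = τ • φ.symm z at h1
  conv_lhs => rw [← φ.apply_symm_apply (z : AlgebraicClosure E₂), hσ', h1, ← hτ',
    φ.apply_symm_apply]

end Semilinear

/-! ### §2 Conjugation data attached to `g ∈ Γ_F` with `g E₁₀ = E₂₀` -/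

section ConjData

variable (F E₁ E₂ : Type*) [Field F] [Field E₁] [Field E₂] [Algebra F E₁] [Algebra F E₂]
  [Algebra.IsAlgebraic F E₁] [Algebra.IsAlgebraic F E₂]

/-- The ring isomorphism `φ_g = ι₂ ∘ g ∘ ι₁⁻¹ : Ē₁ ≅ Ē₂` attached to `g ∈ Γ_F` (existence form;
`ι_i = absClosureEmbedding F E_i : F̄ ≅ Ē_i`). [cite: TateCorvallis1979, (1.4.5)] -/
theorem exists_ringEquiv_conj_absClosureEmbedding₂ (g : absoluteGaloisGroup F) :
    ∃ φ : AlgebraicClosure E₁ ≃+* AlgebraicClosure E₂,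
      ∀ a, φ (absClosureEmbedding F E₁ a) = absClosureEmbedding F E₂ (g • a) := by
  refine ⟨((absClosureEquiv F E₁).symm.trans
    ((absoluteGaloisGroup.toAlgEquiv F g).trans (absClosureEquiv F E₂))).toRingEquiv, fun a => ?_⟩
  change absClosureEquiv F E₂ (absoluteGaloisGroup.toAlgEquiv F g
    ((absClosureEquiv F E₁).symm (absClosureEmbedding F E₁ a))) = _
  rw [absClosureEquiv_symm_absClosureEmbedding, absClosureEquiv_apply, absoluteGaloisGroup.smul_def]

omit [Algebra.IsAlgebraic F E₁] [Algebra.IsAlgebraic F E₂] in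
/-- `φ_g⁻¹ (ι₂ b) = ι₁ (g⁻¹ • b)`. [folklore] -/
private theorem symm_absClosureEmbedding_of_conj₂ {g : absoluteGaloisGroup F}
    {φ : AlgebraicClosure E₁ ≃+* AlgebraicClosure E₂}
    (hφι : ∀ a, φ (absClosureEmbedding F E₁ a) = absClosureEmbedding F E₂ (g • a))
    (b : AlgebraicClosure F) :
    φ.symm (absClosureEmbedding F E₂ b) = absClosureEmbedding F E₁ (g⁻¹ • b) := by
  rw [RingEquiv.symm_apply_eq, hφι, smul_inv_smul]

omit [Algebra.IsAlgebraic F E₁] [Algebra.IsAlgebraic F E₂] in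
/-- `g G_{E₁₀} g⁻¹ ⊆ G_{E₂₀}` when `g E₁₀ = E₂₀`. [cite: NeukirchANT1999, Ch. IV Prop. (5.8)] -/
theorem conj_mem_galFixing₂ {g : absoluteGaloisGroup F}
    (hg : ∀ a, g • a ∈ embField F E₂ ↔ a ∈ embField F E₁) {h : absoluteGaloisGroup F}
    (hh : h ∈ galFixing F (embField F E₁)) : g * h * g⁻¹ ∈ galFixing F (embField F E₂) := by
  rw [mem_galFixing_iff] at hh ⊢
  intro b hb
  have ha : g⁻¹ • b ∈ embField F E₁ := (hg _).mp (by rwa [smul_inv_smul])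
  rw [mul_smul, mul_smul, hh _ ha, smul_inv_smul]

/-- `φ_g` is `γ`-semilinear for a ring isomorphism `γ = g|_{E₁₀} : E₁ ≅ E₂` (read through
`E_i ≅ E_{i0}`), when `g E₁₀ = E₂₀`: existence of `γ` with `φ_g ∘ algebraMap = algebraMap ∘ γ`.
[cite: NeukirchANT1999, Ch. IV Prop. (5.8)] -/
theorem exists_ringEquiv_semilinear₂ {g : absoluteGaloisGroup F}
    (hg : ∀ a, g • a ∈ embField F E₂ ↔ a ∈ embField F E₁)
    {φ : AlgebraicClosure E₁ ≃+* AlgebraicClosure E₂}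
    (hφι : ∀ a, φ (absClosureEmbedding F E₁ a) = absClosureEmbedding F E₂ (g • a)) :
    ∃ γ : E₁ ≃+* E₂, ∀ x : E₁,
      φ (algebraMap E₁ (AlgebraicClosure E₁) x) = algebraMap E₂ (AlgebraicClosure E₂) (γ x) := by
  -- `g| : E₁₀ → E₂₀`
  let mid : embField F E₁ →+* embField F E₂ :=
    { toFun := fun a => ⟨g • (a : AlgebraicClosure F), (hg _).mpr a.2⟩
      map_one' := Subtype.ext (by
        change g • ((1 : embField F E₁) : AlgebraicClosure F) = 1
        rw [absoluteGaloisGroup.smul_def, OneMemClass.coe_one, map_one])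
      map_mul' := fun a b => Subtype.ext (by
        change g • ((a * b : embField F E₁) : AlgebraicClosure F) =
          g • (a : AlgebraicClosure F) * g • (b : AlgebraicClosure F)
        rw [absoluteGaloisGroup.smul_def, absoluteGaloisGroup.smul_def, absoluteGaloisGroup.smul_def,
          MulMemClass.coe_mul, map_mul])
      map_zero' := Subtype.ext (by
        change g • ((0 : embField F E₁) : AlgebraicClosure F) = 0
        rw [absoluteGaloisGroup.smul_def, ZeroMemClass.coe_zero, map_zero])
      map_add' := fun a b => Subtype.ext (by
        change g • ((a + b : embField F E₁) : AlgebraicClosure F) =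
          g • (a : AlgebraicClosure F) + g • (b : AlgebraicClosure F)
        rw [absoluteGaloisGroup.smul_def, absoluteGaloisGroup.smul_def, absoluteGaloisGroup.smul_def,
          AddMemClass.coe_add, map_add]) }
  have hmid : ∀ a : embField F E₁, ((mid a : embField F E₂) : AlgebraicClosure F) =
      g • (a : AlgebraicClosure F) := fun _ => rfl
  have hbij : Function.Bijective mid := by
    constructor
    · intro a b hab
      have h1 := congrArg (fun c : embField F E₂ => (c : AlgebraicClosure F)) hab
      simp only [hmid] at h1
      exact Subtype.ext (smul_left_cancel g h1)
    · intro b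
      have hb : g⁻¹ • (b : AlgebraicClosure F) ∈ embField F E₁ :=
        (hg _).mp (by rw [smul_inv_smul]; exact b.2)
      exact ⟨⟨_, hb⟩, Subtype.ext (by rw [hmid]; exact smul_inv_smul g (b : AlgebraicClosure F))⟩
  let γ : E₁ ≃+* E₂ :=
    ((equivEmbField F E₁ : E₁ ≃ₐ[F] embField F E₁).toRingEquiv.trans
      (RingEquiv.ofBijective mid hbij)).trans (equivEmbField F E₂).symm.toRingEquiv
  refine ⟨γ, fun x => ?_⟩
  change φ (algebraMap E₁ (AlgebraicClosure E₁) x) =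
    algebraMap E₂ (AlgebraicClosure E₂) ((equivEmbField F E₂).symm (mid (equivEmbField F E₁ x)))
  rw [← absClosureEmbedding_coe_eq, hmid, ← hφι, absClosureEmbedding_equivEmbField]

omit [Algebra.IsAlgebraic F E₂] in
/-- **Conjugation by `g` read on `Ē₁ → Ē₂`**: if `res₂ σ' = g · res₁ σ · g⁻¹` in `Γ_F`
(`σ ∈ Γ_{E₁}`, `σ' ∈ Γ_{E₂}`), then `σ' ∘ φ_g = φ_g ∘ σ`. [cite: TateCorvallis1979, (1.4.5)] -/
theorem smul_map_of_absGaloisRestrict_eq_conj₂ {g : absoluteGaloisGroup F}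
    {φ : AlgebraicClosure E₁ ≃+* AlgebraicClosure E₂}
    (hφι : ∀ a, φ (absClosureEmbedding F E₁ a) = absClosureEmbedding F E₂ (g • a))
    {σ : absoluteGaloisGroup E₁} {σ' : absoluteGaloisGroup E₂}
    (hσ' : absGaloisRestrict F E₂ σ' = g * absGaloisRestrict F E₁ σ * g⁻¹)
    (z : AlgebraicClosure E₁) : σ' • φ z = φ (σ • z) := by
  obtain ⟨a, rfl⟩ := (absClosureEmbedding_bijective F E₁).2 z
  rw [hφι, ← absGaloisRestrict_apply_smul, hσ', mul_smul, mul_smul, inv_smul_smul, ← hφι,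
    absGaloisRestrict_apply_smul]

end ConjData

/-! ### §3 The datum side: conjugation by `ρ ∈ W_F` with `ρ E₁₀ = E₂₀` -/

section Datum

variable (F E₁ E₂ : Type*) [Field F] [ValuativeRel F] [TopologicalSpace F]
  [IsNonarchimedeanLocalField F]
  [Field E₁] [Algebra F E₁] [FiniteDimensional F E₁] [Algebra.IsSeparable F E₁]
  [Field E₂] [Algebra F E₂] [FiniteDimensional F E₂] [Algebra.IsSeparable F E₂]

omit [FiniteDimensional F E₁] [Algebra.IsSeparable F E₁] [FiniteDimensional F E₂]
  [Algebra.IsSeparable F E₂] in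
/-- `ρ U_{E₁} ρ⁻¹ = U_{E₂}` for `U_{E_i} = W_F ∩ G_{E_{i0}}` when `ρ E₁₀ = E₂₀` (`ρ ∈ W_F`).
[cite: NeukirchANT1999, Ch. IV Prop. (5.8)] -/
theorem conjSub_fieldSubgroup_embField₂ (ρ : WeilGroup F)
    (hρ : ∀ a, WeilGroup.toAbsGalois F ρ • a ∈ embField F E₂ ↔ a ∈ embField F E₁) :
    conjSub ρ (fieldSubgroup F (embField F E₁)) = fieldSubgroup F (embField F E₂) := by
  ext τ
  rw [mem_conjSub_iff, fieldSubgroup, fieldSubgroup, Subgroup.mem_comap, Subgroup.mem_comap,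
    map_mul, map_mul, map_inv]
  constructor
  · intro h
    have h' := conj_mem_galFixing₂ F E₁ E₂ hρ h
    have e : WeilGroup.toAbsGalois F ρ * ((WeilGroup.toAbsGalois F ρ)⁻¹ * WeilGroup.toAbsGalois F τ *
        WeilGroup.toAbsGalois F ρ) * (WeilGroup.toAbsGalois F ρ)⁻¹ = WeilGroup.toAbsGalois F τ := by
      group
    rwa [e] at h'
  · intro h
    have hρ' : ∀ a, (WeilGroup.toAbsGalois F ρ)⁻¹ • a ∈ embField F E₁ ↔ a ∈ embField F E₂ :=
      fun a => by rw [← hρ, smul_inv_smul]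
    have h' := conj_mem_galFixing₂ F E₂ E₁ hρ' h
    rwa [inv_inv] at h'

omit [FiniteDimensional F E₁] [Algebra.IsSeparable F E₁] [FiniteDimensional F E₂]
  [Algebra.IsSeparable F E₂] in
/-- `ρ w ρ⁻¹ ∈ U_{E₂}` for `w ∈ U_{E₁}`, `ρ E₁₀ = E₂₀`. [folklore] -/
private theorem conj_mem_fieldSubgroup_embField₂ (ρ : WeilGroup F)
    (hρ : ∀ a, WeilGroup.toAbsGalois F ρ • a ∈ embField F E₂ ↔ a ∈ embField F E₁)
    (w : fieldSubgroup F (embField F E₁)) :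
    ρ * w * ρ⁻¹ ∈ fieldSubgroup F (embField F E₂) :=
  (conjSub_fieldSubgroup_embField₂ F E₁ E₂ ρ hρ).le (conj_mem_conjSub_iff.mpr w.2)

variable {F E₁ E₂}

omit [FiniteDimensional F E₁] [Algebra.IsSeparable F E₁] [FiniteDimensional F E₂]
  [Algebra.IsSeparable F E₂] in
/-- `W_F ∩ G_{ι₂⁻¹(φ_ρ L')} = ρ (W_F ∩ G_{ι₁⁻¹ L'}) ρ⁻¹`: the Weil subgroup of the image `φ_ρ L' ⊆ Ē₂`
of `L' ⊆ Ē₁` under `φ_ρ = ι₂ ρ ι₁⁻¹` is the conjugate Weil subgroup.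
[cite: NeukirchANT1999, Ch. IV Prop. (5.8)] -/
theorem fieldSubgroup_embFieldOf_semilinearImage₂ (ρ : WeilGroup F)
    {φ : AlgebraicClosure E₁ ≃+* AlgebraicClosure E₂}
    (hφι : ∀ a, φ (absClosureEmbedding F E₁ a) =
      absClosureEmbedding F E₂ (WeilGroup.toAbsGalois F ρ • a))
    {L' : IntermediateField E₁ (AlgebraicClosure E₁)} {M : IntermediateField E₂ (AlgebraicClosure E₂)}
    (hM : ∀ z, z ∈ M ↔ φ.symm z ∈ L') :
    fieldSubgroup F (embFieldOf F E₂ M) = conjSub ρ (fieldSubgroup F (embFieldOf F E₁ L')) := by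
  have key : ∀ b, absClosureEmbedding F E₂ b ∈ M ↔
      absClosureEmbedding F E₁ ((WeilGroup.toAbsGalois F ρ)⁻¹ • b) ∈ L' := fun b => by
    rw [hM, symm_absClosureEmbedding_of_conj₂ F E₁ E₂ hφι]
  ext τ
  rw [mem_conjSub_iff, mem_fieldSubgroup_iff, mem_fieldSubgroup_iff]
  simp only [mem_embFieldOf_iff, map_mul, map_inv]
  constructor
  · intro h a ha
    have hb : absClosureEmbedding F E₂ (WeilGroup.toAbsGalois F ρ • a) ∈ M := by
      rw [key, inv_smul_smul]
      exact ha
    rw [mul_smul, mul_smul, h _ hb, inv_smul_smul]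
  · intro h b hb
    have h1 := h _ ((key b).mp hb)
    rw [mul_smul, mul_smul, smul_inv_smul] at h1
    exact smul_left_cancel _ h1

/-- `ρ · ι₁⁻¹ x = ι₂⁻¹ (γ x)` in `A = (F^sep)ˣ`, for `φ_ρ` `γ`-semilinear.
[cite: NeukirchANT1999, Ch. IV Prop. (5.8)] -/
theorem smul_unitE₂ (ρ : WeilGroup F) {φ : AlgebraicClosure E₁ ≃+* AlgebraicClosure E₂}
    (hφι : ∀ a, φ (absClosureEmbedding F E₁ a) =
      absClosureEmbedding F E₂ (WeilGroup.toAbsGalois F ρ • a))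
    {γ : E₁ ≃+* E₂}
    (hφ : ∀ x : E₁, φ (algebraMap E₁ (AlgebraicClosure E₁) x) =
      algebraMap E₂ (AlgebraicClosure E₂) (γ x))
    (x : E₁ˣ) : ρ • unitE F E₁ x = unitE F E₂ (Units.map (γ : E₁ →* E₂) x) := by
  apply Units.ext
  apply Subtype.ext
  apply (absClosureEmbedding_bijective F E₂).1
  rw [coe_smul, ← hφι, absClosureEmbedding_coe_unitE, absClosureEmbedding_coe_unitE, hφ]
  rfl

/-- **Finite-level equivariance across two fields** (Neukirch IV (5.8) right-hand square, inside
the Weil datum of `F` via `recMap_conjSub`): if `(x, L'/E₁) = w|_{L'}` then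
`(γ x, φ_ρ L'/E₂) = (ρ w ρ⁻¹)|_{φ_ρ L'}` (`ρ ∈ W_F`, `ρ E₁₀ = E₂₀`).
[cite: NeukirchANT1999, Ch. IV Prop. (5.8)] -/
theorem recSystemE_semilinearImage₂ (hcf : (localWeilDatum F).IsClassFieldTheory) (ρ : WeilGroup F)
    (hρ : ∀ a, WeilGroup.toAbsGalois F ρ • a ∈ embField F E₂ ↔ a ∈ embField F E₁)
    {φ : AlgebraicClosure E₁ ≃+* AlgebraicClosure E₂}
    (hφι : ∀ a, φ (absClosureEmbedding F E₁ a) =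
      absClosureEmbedding F E₂ (WeilGroup.toAbsGalois F ρ • a))
    {γ : E₁ ≃+* E₂}
    (hφ : ∀ x : E₁, φ (algebraMap E₁ (AlgebraicClosure E₁) x) =
      algebraMap E₂ (AlgebraicClosure E₂) (γ x))
    {L' : IntermediateField E₁ (AlgebraicClosure E₁)} {M : IntermediateField E₂ (AlgebraicClosure E₂)}
    (hM : ∀ z, z ∈ M ↔ φ.symm z ∈ L')
    [FiniteDimensional E₁ L'] [IsAbelianGalois E₁ L'] [FiniteDimensional E₂ M] [IsAbelianGalois E₂ M]
    (x : E₁ˣ) (w : fieldSubgroup F (embField F E₁))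
    (h : recSystemE hcf L' x = weilRestrictE F E₁ L' w) :
    recSystemE hcf M (Units.map (γ : E₁ →* E₂) x) =
      weilRestrictE F E₂ M ⟨ρ * w * ρ⁻¹, conj_mem_fieldSubgroup_embField₂ F E₁ E₂ ρ hρ w⟩ := by
  set d := localWeilDatum F
  have hab := isAbelianPair_embField F E₁ L'
  rw [recSystemE_eq_weilRestrictE_iff] at h ⊢
  have hconj := hcf.recMap_conjSub hab.isField_left hab.isField_right hab.le hab.le_normalizer w.2 ρ
  rw [h, QuotientGroup.map_mk, MulDistribMulAction.toMonoidHom_apply, smul_unitE₂ ρ hφι hφ] at hconj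
  have key : ∀ U₁ V₁ : Subgroup (WeilGroup F), U₁ = conjSub ρ (fieldSubgroup F (embField F E₁)) →
      V₁ = conjSub ρ (fieldSubgroup F (embFieldOf F E₁ L')) →
      d.recMap U₁ V₁ (ρ * w * ρ⁻¹) =
        QuotientGroup.mk (unitE F E₂ (Units.map (γ : E₁ →* E₂) x)) := by
    rintro _ _ rfl rfl
    exact hconj
  exact key _ _ (conjSub_fieldSubgroup_embField₂ F E₁ E₂ ρ hρ).symm
    (fieldSubgroup_embFieldOf_semilinearImage₂ ρ hφι hM)

end Datum

end LocalWeilDatum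

end Literature.NumberTheory.GaloisRepresentations
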